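import Summits.KontsevichZagierPeriods.KontsevichZagierPeriods.Theorems.RootDecompRelativeModAbsoluteCircleLogP6

/-! # `RootDecompRelativeModAbsoluteCircleLogP7` — part 7/11 of the mechanical ≤400-line split of `CircleLogTranscendence_landing.lean` (sha256 022159109aaffa3a…)
Source: decomp-kz lens-3 g13 `CircleLogTranscendence_v9.lean` (HOME/decomp-kz-lens-3/g13/, sha256 afb45a43…; critic g5-45/60/65/68/69 CLEARED FOR LANDING --supports 30572 (§4 defs, §8–§10 CircleLogStructureAt 0 from the tree's baker_decomposition_complex, constant-data cells every n, §16–§23 descent ingredients); landed by census-1 g9 over the landed CylLogSplitP52 (BLOCK G13): the duplicate def CircleLogStructure is dropped in favour of the landed one).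
Split by census-1 g9 `gen/splitlean.py`: scopes re-opened with their `open`/`variable`/`set_option` context; mathematics and declaration order unchanged. -/

noncomputable section
open Set MeasureTheory Filter Topology
open scoped BigOperators
open Literature.NumberTheory.Transcendental Literature.ModelTheory.ExponentialFields
namespace Summit.KontsevichZagierPeriods.RootDecompRelativeModAbsolute.Rung30571.RegularisedLogLayer.CylLog.Leaf
namespace G13

open scoped ContDiff in
/-- **`CircleLogStructureAt 1 ⟸ CircleLogStructureMovingCirc` — PROVED** (constant-data interval cells are discharged by §9's
`circleLogStructure_constData`).  Partition: smooth locus of all `Wᵢ, uⱼ` (null complement) → interval cells of the tree's level-1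
CAD adapted to the zero sets of the partial derivatives `∂Wᵢ, ∂uⱼ` (which are `ℚ`-sa) → on each interval every derivative is `≡ 0`
or nowhere `0`; all `≡ 0` ⇒ constant data (convexity) ⇒ §9; otherwise the cell is MOVING ⇒ the residual; the two-level a.e.
partition is flattened. -/
theorem circleLogStructureAt_one_of_movingCirc (hMov : CircleLogStructureMovingCirc) : CircleLogStructureAt 1 := by
  classical
  intro k l U h W p u g hU hh hW hW0 hp hu hg hid
  -- smooth locus of the `W`, `u`
  obtain ⟨G₁, hG₁U, hG₁o, hG₁, hWsm, hn₁⟩ := exists_open_smooth_subset hU W hW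
  obtain ⟨G, hGG₁, hGo, hG, husm, hn₂⟩ :=
    exists_open_smooth_subset hG₁ u fun j => (hu j).mono hG₁U hG₁
  have hGU : G ⊆ U := hGG₁.trans hG₁U
  have hWsm' : ∀ i, ContDiffOn ℝ ∞ (W i) G := fun i => (hWsm i).mono hGG₁
  have hWd : ∀ i, ∀ x ∈ G, DifferentiableAt ℝ (W i) x := fun i x hx =>
    ((hWsm' i).differentiableOn (by simp)).differentiableAt (hGo.mem_nhds hx)
  have hud : ∀ j, ∀ x ∈ G, DifferentiableAt ℝ (u j) x := fun j x hx =>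
    ((husm j).differentiableOn (by simp)).differentiableAt (hGo.mem_nhds hx)
  -- the partial derivatives are `ℚ`-sa on `G`; their zero sets
  set dW : Fin k → (Fin 1 → ℝ) → ℝ := fun i x => fderiv ℝ (W i) x (Pi.single 0 1) with hdW_def
  set du : Fin l → (Fin 1 → ℝ) → ℝ := fun j x => fderiv ℝ (u j) x (Pi.single 0 1) with hdu_def
  have hdW : ∀ i, IsSemialgebraicFunOn ℚ G (dW i) := fun i =>
    IsSemialgebraicFunOn.fderiv_apply_single hGo ((hW i).mono hGU hG) (hWd i) 0
  have hdu : ∀ j, IsSemialgebraicFunOn ℚ G (du j) := fun j =>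
    IsSemialgebraicFunOn.fderiv_apply_single hGo ((hu j).mono hGU hG) (hud j) 0
  set Z₀ : Fin (k + l) → Set (Fin 1 → ℝ) :=
    Fin.append (fun i => {x | x ∈ G ∧ dW i x = 0}) (fun j => {x | x ∈ G ∧ du j x = 0}) with hZ₀_def
  have hZ₀ : ∀ t, IsSemialgebraic ℚ (Z₀ t) := by
    intro t
    induction t using Fin.addCases with
    | left i => simp only [hZ₀_def, Fin.append_left]; exact (hdW i).isSemialgebraic_sep_eq_zero
    | right j => simp only [hZ₀_def, Fin.append_right]; exact (hdu j).isSemialgebraic_sep_eq_zero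
  -- and the zero sets of the arctangent coefficients `p j`
  set Z : Fin ((k + l) + l) → Set (Fin 1 → ℝ) :=
    Fin.append Z₀ (fun j => {x | x ∈ G ∧ p j x = 0}) with hZ_def
  have hZ : ∀ t, IsSemialgebraic ℚ (Z t) := by
    intro t
    induction t using Fin.addCases with
    | left t => simp only [hZ_def, Fin.append_left]; exact hZ₀ t
    | right j => simp only [hZ_def, Fin.append_right]; exact ((hp j).mono hGU hG).isSemialgebraic_sep_eq_zero
  obtain ⟨B, T, hT, hTd, hTn, hTZ⟩ := exists_interval_cells hG Z hZ
  -- per interval cell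
  have hcellCLS : ∀ b, ∃ (N : ℕ) (C : Fin N → Set (Fin 1 → ℝ)),
      (∀ c, IsSemialgebraic ℚ (C c) ∧ IsOpen (C c) ∧ C c ⊆ T b) ∧
      Pairwise (Function.onFun Disjoint C) ∧ volume (T b \ ⋃ c, C c) = 0 ∧
      ∀ c, (∀ x ∈ C c, g x = 0) ∧
        ∃ (R : ℕ) (f : Fin R → Fin k → ℤ) (q : Fin R → (Fin 1 → ℝ) → ℝ)
          (S : ℕ) (f' : Fin S → Fin l → ℤ) (m : Fin S → ℚ) (q' : Fin S → (Fin 1 → ℝ) → ℝ),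
          (∀ r, IsSemialgebraicFunOn ℚ (C c) (q r)) ∧ (∀ r, ∀ x ∈ C c, ∏ i, W i x ^ (f r i) = 1) ∧
          (∀ i, ∀ x ∈ C c, h i x = ∑ r, q r x * (f r i : ℝ)) ∧
          (∀ s, IsSemialgebraicFunOn ℚ (C c) (q' s)) ∧
          (∀ s, ∀ x ∈ C c, ∑ j, (f' s j : ℝ) * Real.arctan (u j x) = (m s : ℝ) * Real.pi) ∧
          (∀ x ∈ C c, ∑ s, q' s x * (m s : ℝ) = 0) ∧
          (∀ j, ∀ x ∈ C c, p j x = ∑ s, q' s x * (f' s j : ℝ)) := by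
    intro b
    obtain ⟨hTsa, hTo, hTc, hTG⟩ := hT b
    have hTU : T b ⊆ U := hTG.trans hGU
    have hWdich : ∀ i, (∀ x ∈ T b, dW i x = 0) ∨ (∀ x ∈ T b, dW i x ≠ 0) := by
      intro i
      rcases hTZ b (Fin.castAdd l (Fin.castAdd l i)) with hsub | hdis
      · left
        intro x hx
        have h1 := hsub hx
        simp only [hZ_def, hZ₀_def, Fin.append_left] at h1
        exact h1.2
      · right
        intro x hx h0
        refine Set.disjoint_left.mp hdis hx ?_
        simp only [hZ_def, hZ₀_def, Fin.append_left]
        exact ⟨hTG hx, h0⟩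
    have hudich : ∀ j, (∀ x ∈ T b, du j x = 0) ∨ (∀ x ∈ T b, du j x ≠ 0) := by
      intro j
      rcases hTZ b (Fin.castAdd l (Fin.natAdd k j)) with hsub | hdis
      · left
        intro x hx
        have h1 := hsub hx
        simp only [hZ_def, hZ₀_def, Fin.append_left, Fin.append_right] at h1
        exact h1.2
      · right
        intro x hx h0
        refine Set.disjoint_left.mp hdis hx ?_
        simp only [hZ_def, hZ₀_def, Fin.append_left, Fin.append_right]
        exact ⟨hTG hx, h0⟩
    have hpdich : ∀ j, (∀ x ∈ T b, p j x = 0) ∨ (∀ x ∈ T b, p j x ≠ 0) := by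
      intro j
      rcases hTZ b (Fin.natAdd (k + l) j) with hsub | hdis
      · left
        intro x hx
        have h1 := hsub hx
        simp only [hZ_def, Fin.append_right] at h1
        exact h1.2
      · right
        intro x hx h0
        refine Set.disjoint_left.mp hdis hx ?_
        simp only [hZ_def, Fin.append_right]
        exact ⟨hTG hx, h0⟩
    have hh' : ∀ i, IsSemialgebraicFunOn ℚ (T b) (h i) := fun i => (hh i).mono hTU hTsa
    have hW' : ∀ i, IsSemialgebraicFunOn ℚ (T b) (W i) := fun i => (hW i).mono hTU hTsa
    have hW0' : ∀ i, ∀ x ∈ T b, 0 < W i x := fun i x hx => hW0 i x (hTU hx)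
    have hp' : ∀ j, IsSemialgebraicFunOn ℚ (T b) (p j) := fun j => (hp j).mono hTU hTsa
    have hu' : ∀ j, IsSemialgebraicFunOn ℚ (T b) (u j) := fun j => (hu j).mono hTU hTsa
    have hg' : IsSemialgebraicFunOn ℚ (T b) g := hg.mono hTU hTsa
    have hid' : ∀ x ∈ T b, ∑ i, h i x * Real.log (W i x) + ∑ j, p j x * Real.arctan (u j x) = g x :=
      fun x hx => hid x (hTU hx)
    by_cases hpz : ∀ j, ∀ x ∈ T b, p j x = 0
    · -- LOG-linear cell: the tree's structure theorem
      exact circleLogStructureAt_of_p_eq_zero 1 k l (T b) h W p u g hTsa hh' hW' hW0' hg' hpz hid'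
    have hpnz : ∃ j, ∀ x ∈ T b, p j x ≠ 0 := by
      push Not at hpz
      obtain ⟨j, x, hx, hne⟩ := hpz
      exact ⟨j, (hpdich j).resolve_left fun h0 => hne (h0 x hx)⟩
    by_cases hmov : (∃ i, ∀ x ∈ T b, dW i x ≠ 0) ∨ (∃ j, ∀ x ∈ T b, du j x ≠ 0)
    · exact hMov k l (T b) h W p u g hTsa hTo hTc hh' hW' hW0' hp' hu' hg' (fun i => (hWsm' i).mono hTG)
        (fun j => (husm j).mono hTG) hWdich hudich hmov hpdich hpnz hid'
    · push Not at hmov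
      obtain ⟨hmW, hmu⟩ := hmov
      have hWz : ∀ i, ∀ x ∈ T b, dW i x = 0 := fun i => (hWdich i).resolve_right fun hne => by
        obtain ⟨x, hx, h0⟩ := hmW i
        exact hne x hx h0
      have huz : ∀ j, ∀ x ∈ T b, du j x = 0 := fun j => (hudich j).resolve_right fun hne => by
        obtain ⟨x, hx, h0⟩ := hmu j
        exact hne x hx h0
      have hWc : ∀ i, ∀ x ∈ T b, ∀ y ∈ T b, W i x = W i y := fun i =>
        eq_of_fderiv_single_eq_zero hTo hTc (((hWsm' i).mono hTG).differentiableOn (by simp)) (hWz i)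
      have huc : ∀ j, ∀ x ∈ T b, ∀ y ∈ T b, u j x = u j y := fun j =>
        eq_of_fderiv_single_eq_zero hTo hTc (((husm j).mono hTG).differentiableOn (by simp)) (huz j)
      exact circleLogStructure_constData hTsa hTo hh' hW' hW0' hp' hu' hg' hWc huc hid'
  choose N C hC hCd hCn hdata using hcellCLS
  obtain ⟨M, E, hE, hEd, hEn⟩ := exists_flatten_partition T (fun b => (hT b).2.2.2) hTd hTn N C
    (fun b c => (hC b c).2.2) hCd hCn
    (P := fun S => IsSemialgebraic ℚ S ∧ IsOpen S ∧ ((∀ x ∈ S, g x = 0) ∧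
        ∃ (R : ℕ) (f : Fin R → Fin k → ℤ) (q : Fin R → (Fin 1 → ℝ) → ℝ)
          (S' : ℕ) (f' : Fin S' → Fin l → ℤ) (m : Fin S' → ℚ) (q' : Fin S' → (Fin 1 → ℝ) → ℝ),
          (∀ r, IsSemialgebraicFunOn ℚ S (q r)) ∧ (∀ r, ∀ x ∈ S, ∏ i, W i x ^ (f r i) = 1) ∧
          (∀ i, ∀ x ∈ S, h i x = ∑ r, q r x * (f r i : ℝ)) ∧
          (∀ s, IsSemialgebraicFunOn ℚ S (q' s)) ∧
          (∀ s, ∀ x ∈ S, ∑ j, (f' s j : ℝ) * Real.arctan (u j x) = (m s : ℝ) * Real.pi) ∧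
          (∀ x ∈ S, ∑ s, q' s x * (m s : ℝ) = 0) ∧
          (∀ j, ∀ x ∈ S, p j x = ∑ s, q' s x * (f' s j : ℝ))))
    (fun b c => ⟨(hC b c).1, (hC b c).2.1, hdata b c⟩)
  refine ⟨M, E, fun j => ⟨(hE j).2.1, (hE j).2.2.1, (hE j).1.trans hGU⟩, hEd, ?_, fun j => (hE j).2.2.2⟩
  have hUG : volume (U \ G) = 0 :=
    measure_mono_null (fun x hx => by
      by_cases h1 : x ∈ G₁
      · exact Or.inr ⟨h1, hx.2⟩
      · exact Or.inl ⟨hx.1, h1⟩) (measure_union_null hn₁ hn₂)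
  exact measure_mono_null (fun x hx => by
    by_cases hxG : x ∈ G
    · exact Or.inr ⟨hxG, hx.2⟩
    · exact Or.inl ⟨hx.1, hxG⟩) (measure_union_null hUG hEn)

/-! ### §14 `CircleBoundaryRigidity` SPLIT: structure + a TRANSCENDENCE-FREE circle fold (PROVED glue), node v4

As in the tree (`boundaryRigidity_of_stubs` = descent + cellwise fold), `CircleBoundaryRigidityAt n ⟸ CircleLogStructureAt n ∧
CircleCellwiseFoldAt n` (`circleBoundaryRigidityAt_of_CLS_fold`).  Since the chain consumes `CircleBoundaryRigidityAt 1` only (refactor: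
`r1C_of_circleBoundaryRigidity`, `r1C₂_…`, `tameCloseC` take `CircleBoundaryRigidityAt b`, `cellCloseCSTame_of_circleBoundaryRigidity` and
`cylKernelZeroCirclePos_of_CLS_CBR_wild` take `… 1`) and `CircleLogStructureAt 1 ⟸ CircleLogStructureMovingCirc` (§12), the node becomes
`CylKernelZeroCirclePos ⟸ CircleLogStructureMovingCirc ∧ CircleCellwiseFoldAt 1 ∧ CellCloseCSWild` — ONE transcendence statement (functional,
genuinely circular) and TWO KZ-calculus statements (the exact-relation fold; the wild residual). -/

/-- A representation whose integrand vanishes on its domain off a null `ℚ`-semialgebraic subset is a relation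
(VERBATIM COPY of `LiouvilleUnfolding.LogPrimitiveNL.of_mem_relations_of_eqOn_zero_off_null`,
`Theorems/LiouvilleUnfoldingLogPrimitiveNLGlue.lean` — farm-unbuilt tonight; drop for the import). [folklore] -/
private theorem of_mem_relations_of_eqOn_zero_off_null' :
    ∀ (n : ℕ) (g : KZ.IntegralRep n) (A : Set (Fin n → ℝ)), IsSemialgebraic ℚ A → A ⊆ g.domain →
      volume (g.domain \ A) = 0 → (∀ x ∈ A, g.integrand x = 0) → KZ.of g ∈ KZ.relations := by
  intro n g A hA hAg hnull hzero
  have hB : IsSemialgebraic ℚ (g.domain \ A) := g.isSemialgebraic_domain.diff hA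
  set gA := g.restrict A hA hAg with hgA
  set gB := g.restrict (g.domain \ A) hB sdiff_subset with hgB
  have hsplit : KZ.of g - KZ.of gA - KZ.of gB ∈ KZ.relations := by
    refine KZ.domainAddRel_subset_relations ⟨n, g, gA, gB, ?_, ?_, fun _ _ => rfl, fun _ _ => rfl,
      rfl⟩
    · simp only [hgA, hgB, KZ.IntegralRep.domain_restrict, union_sdiff_self]
      exact (union_eq_self_of_subset_left hAg).symm
    · simp only [hgA, hgB, KZ.IntegralRep.domain_restrict, inter_sdiff_self, measure_empty]
  have h1 : KZ.of gA ∈ KZ.relations :=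
    KZ.of_mem_relations_of_eqOn_zero gA fun x hx => by simpa [hgA] using hzero x hx
  have h2 : KZ.of gB ∈ KZ.relations := KZ.of_mem_relations_of_volume_eq_zero gB hnull
  have : KZ.of g = (KZ.of g - KZ.of gA - KZ.of gB) + KZ.of gA + KZ.of gB := by abel
  rw [this]
  exact KZ.relations.add_mem (KZ.relations.add_mem hsplit h1) h2

/-- **The CIRCLE CELLWISE FOLD** (twin of the tree's `stub_cellwiseFold`, with the arctangent bands added) — the
TRANSCENDENCE-FREE half of `CircleBoundaryRigidityAt n`: given an a.e. open `ℚ`-sa partition of the base into cells carrying EXACT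
integer relations — multiplicative `∏ Wᵢ^{f r i} = 1` spanning the log coefficients `hᵢ`, and angle relations
`Σⱼ f′ s j · arctan uⱼ = m s · π` with `Σ_s q′ s · m s = 0` spanning the arctangent coefficients `pⱼ`, all with `ℚ`-sa coefficients —
the honest band monomials `[1≤t≤Wᵢ, hᵢ/t]`, `[0≤t≤uⱼ, pⱼ/(1+t²)]` sum to a relation.  [KZ calculus only: log multiplicativity by the
cone decomposition (tree `stub_coneDecomposition` / `stub_cellwiseFold` for the log family), angle addition by the Möbius engine
(g12 `angle_addition_mem_relations`, `reciprocal_mem_relations`), and the `π`-budget `Σ q′ m = 0`; WEAKER · THEOREM-TYPE · ATTACKABLE] -/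
def CircleCellwiseFoldAt (n : ℕ) : Prop :=
  ∀ (k l : ℕ) (σ : Set (Fin n → ℝ)) (h W : Fin k → (Fin n → ℝ) → ℝ) (p u : Fin l → (Fin n → ℝ) → ℝ)
    (U : Fin k → KZ.IntegralRep (n + 1)) (A : Fin l → KZ.IntegralRep (n + 1)) (N : ℕ) (C : Fin N → Set (Fin n → ℝ)),
    IsSemialgebraic ℚ σ →
    (∀ i, IsSemialgebraicFunOn ℚ σ (h i)) → (∀ i, IsSemialgebraicFunOn ℚ σ (W i)) →
    (∀ j, IsSemialgebraicFunOn ℚ σ (p j)) → (∀ j, IsSemialgebraicFunOn ℚ σ (u j)) →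
    (∀ i, ∀ x ∈ σ, 1 ≤ W i x) → (∀ j, ∀ x ∈ σ, 0 ≤ u j x) →
    (∀ i, (U i).domain = {z | (Fin.init z : Fin n → ℝ) ∈ σ ∧ 1 ≤ z (Fin.last n) ∧
      z (Fin.last n) ≤ W i (Fin.init z)}) →
    (∀ i, EqOn (U i).integrand (fun z => h i (Fin.init z) / z (Fin.last n)) (U i).domain) →
    (∀ j, (A j).domain = {z | (Fin.init z : Fin n → ℝ) ∈ σ ∧ 0 ≤ z (Fin.last n) ∧
      z (Fin.last n) ≤ u j (Fin.init z)}) →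
    (∀ j, EqOn (A j).integrand (fun z => p j (Fin.init z) / (1 + z (Fin.last n) ^ 2)) (A j).domain) →
    (∀ i, IntegrableOn (fun x => h i x * Real.log (W i x)) σ) →
    (∀ j, IntegrableOn (fun x => p j x * Real.arctan (u j x)) σ) →
    (∀ c, IsSemialgebraic ℚ (C c) ∧ IsOpen (C c) ∧ C c ⊆ σ) →
    Pairwise (Function.onFun Disjoint C) → volume (σ \ ⋃ c, C c) = 0 →
    (∀ c, ∃ (R : ℕ) (f : Fin R → Fin k → ℤ) (q : Fin R → (Fin n → ℝ) → ℝ)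
        (S : ℕ) (f' : Fin S → Fin l → ℤ) (m : Fin S → ℚ) (q' : Fin S → (Fin n → ℝ) → ℝ),
        (∀ r, IsSemialgebraicFunOn ℚ (C c) (q r)) ∧ (∀ r, ∀ x ∈ C c, ∏ i, W i x ^ (f r i) = 1) ∧
        (∀ i, ∀ x ∈ C c, h i x = ∑ r, q r x * (f r i : ℝ)) ∧
        (∀ s, IsSemialgebraicFunOn ℚ (C c) (q' s)) ∧
        (∀ s, ∀ x ∈ C c, ∑ j, (f' s j : ℝ) * Real.arctan (u j x) = (m s : ℝ) * Real.pi) ∧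
        (∀ x ∈ C c, ∑ s, q' s x * (m s : ℝ) = 0) ∧
        (∀ j, ∀ x ∈ C c, p j x = ∑ s, q' s x * (f' s j : ℝ))) →
    ∑ i, KZ.of (U i) + ∑ j, KZ.of (A j) ∈ KZ.relations

/-- **`CircleBoundaryRigidityAt n ⟸ CircleLogStructureAt n ∧ CircleCellwiseFoldAt n` — PROVED** (twin of the tree's
`boundaryRigidity_of_stubs` / `boundaryRigidity_of_structure`): the structure theorem gives the cells, `g.integrand ≡ 0` on them
(so `[g]` is a relation, `of_mem_relations_of_eqOn_zero_off_null'`) and the exact relations that the fold turns into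
`Σ [Uᵢ] + Σ [Aⱼ] ∈ relations`. -/
theorem circleBoundaryRigidityAt_of_CLS_fold (n : ℕ) (hCLS : CircleLogStructureAt n) (hF : CircleCellwiseFoldAt n) :
    CircleBoundaryRigidityAt n := by
  intro k l g h W p u U A hh hW hp hu hW1 hu0 hUd hUi hAd hAi hUint hAint hg
  have hσ : IsSemialgebraic ℚ g.domain := g.isSemialgebraic_domain
  have hWpos : ∀ i, ∀ x ∈ g.domain, 0 < W i x := fun i x hx => one_pos.trans_le (hW1 i x hx)
  obtain ⟨N, C, hC, hdisj, hnull, hcell⟩ := hCLS k l g.domain h W p u g.integrand hσ hh hW hWpos hp hu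
    g.isSemialgebraicFunOn_integrand (fun x hx => (hg x hx).symm)
  have hfold : ∑ i, KZ.of (U i) + ∑ j, KZ.of (A j) ∈ KZ.relations :=
    hF k l g.domain h W p u U A N C hσ hh hW hp hu hW1 hu0 hUd hUi hAd hAi hUint hAint hC hdisj hnull
      fun c => (hcell c).2
  have hA : IsSemialgebraic ℚ (⋃ c, C c) := by
    have : (⋃ c, C c) = ⋃ c ∈ (Finset.univ : Finset (Fin N)), C c := by simp
    rw [this]
    exact IsSemialgebraic.biUnion _ _ fun c _ => (hC c).1
  have hg0 : KZ.of g ∈ KZ.relations := by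
    refine of_mem_relations_of_eqOn_zero_off_null' n g (⋃ c, C c) hA
      (iUnion_subset fun c => (hC c).2.2) hnull fun x hx => ?_
    obtain ⟨c, hxc⟩ := mem_iUnion.1 hx
    exact (hcell c).1 x hxc
  exact KZ.relations.sub_mem hfold hg0

/-! ### §15 The fold SPLIT: LOG fold (the tree's theorem) + ANGLE fold (the circular residual), node v5

`CircleCellwiseFoldAt n ⟸ LogCellwiseFoldAt n ∧ AngleCellwiseFoldAt n` (the two band families fold separately).  `LogCellwiseFoldAt n` is
VERBATIM the tree's `stub_cellwiseFold stub_coneDecomposition n` (PROVED; module unbuilt on the farm tonight, so it stays a named hypothesis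
here), and the open KZ-calculus content of boundary rigidity is exactly `AngleCellwiseFoldAt 1`: angle addition in families. -/

/-- The LOG cellwise fold at base dimension `n` — VERBATIM the conclusion of the tree's `stub_cellwiseFold` (route LiouvilleUnfolding,
crux LogPrimitiveNL; `Theorems/LiouvilleUnfoldingLogPrimitiveNLStubCellwiseFold.lean` l.306, PROVED there from `stub_coneDecomposition`;
module farm-unbuilt tonight) specialised to `n`: `LogCellwiseFoldAt n` is `stub_cellwiseFold stub_coneDecomposition n` once importable. -/
def LogCellwiseFoldAt (n : ℕ) : Prop :=
  ∀ (k : ℕ) (σ : Set (Fin n → ℝ)) (h W : Fin k → (Fin n → ℝ) → ℝ)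
    (U : Fin k → KZ.IntegralRep (n + 1)) (N : ℕ) (C : Fin N → Set (Fin n → ℝ)),
    IsSemialgebraic ℚ σ → (∀ i, IsSemialgebraicFunOn ℚ σ (h i)) →
    (∀ i, IsSemialgebraicFunOn ℚ σ (W i)) → (∀ i, ∀ x ∈ σ, 1 ≤ W i x) →
    (∀ i, (U i).domain = {z | (Fin.init z : Fin n → ℝ) ∈ σ ∧ 1 ≤ z (Fin.last n) ∧
      z (Fin.last n) ≤ W i (Fin.init z)}) →
    (∀ i, EqOn (U i).integrand (fun z => h i (Fin.init z) / z (Fin.last n)) (U i).domain) →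
    (∀ i, IntegrableOn (fun x => h i x * Real.log (W i x)) σ) →
    (∀ c, IsSemialgebraic ℚ (C c) ∧ IsOpen (C c) ∧ C c ⊆ σ) →
    Pairwise (Function.onFun Disjoint C) → volume (σ \ ⋃ c, C c) = 0 →
    (∀ c, ∃ (R : ℕ) (f : Fin R → Fin k → ℤ) (q : Fin R → (Fin n → ℝ) → ℝ),
      (∀ r, IsSemialgebraicFunOn ℚ (C c) (q r)) ∧ (∀ r, ∀ x ∈ C c, ∏ i, W i x ^ (f r i) = 1) ∧
      (∀ i, ∀ x ∈ C c, h i x = ∑ r, q r x * (f r i : ℝ))) →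
    ∑ i, KZ.of (U i) ∈ KZ.relations

/-- **The ANGLE cellwise fold** at base dimension `n` — the genuinely circular, transcendence-free residual of boundary rigidity: on cells
carrying EXACT integer angle relations `Σⱼ f′ s j · arctan uⱼ = m s · π` with `ℚ`-sa coefficients `q′ s` of total `π`-budget `Σ_s q′ s · m s = 0`
spanning `pⱼ = Σ_s q′ s · f′ s j`, the honest arctangent bands `[0≤t≤uⱼ, pⱼ/(1+t²)]` sum to a relation.  [angle addition in families by the
g12 Möbius engine (`angle_addition_mem_relations`, `reciprocal_mem_relations`: `t ↦ (t+c)/(1−ct)`, `t ↦ 1/t`), the `π`-rep `4·[0≤t≤1, 1/(1+t²)]`,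
and the budget; WEAKER · THEOREM-TYPE · ATTACKABLE] -/
def AngleCellwiseFoldAt (n : ℕ) : Prop :=
  ∀ (l : ℕ) (σ : Set (Fin n → ℝ)) (p u : Fin l → (Fin n → ℝ) → ℝ)
    (A : Fin l → KZ.IntegralRep (n + 1)) (N : ℕ) (C : Fin N → Set (Fin n → ℝ)),
    IsSemialgebraic ℚ σ → (∀ j, IsSemialgebraicFunOn ℚ σ (p j)) → (∀ j, IsSemialgebraicFunOn ℚ σ (u j)) →
    (∀ j, ∀ x ∈ σ, 0 ≤ u j x) →
    (∀ j, (A j).domain = {z | (Fin.init z : Fin n → ℝ) ∈ σ ∧ 0 ≤ z (Fin.last n) ∧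
      z (Fin.last n) ≤ u j (Fin.init z)}) →
    (∀ j, EqOn (A j).integrand (fun z => p j (Fin.init z) / (1 + z (Fin.last n) ^ 2)) (A j).domain) →
    (∀ j, IntegrableOn (fun x => p j x * Real.arctan (u j x)) σ) →
    (∀ c, IsSemialgebraic ℚ (C c) ∧ IsOpen (C c) ∧ C c ⊆ σ) →
    Pairwise (Function.onFun Disjoint C) → volume (σ \ ⋃ c, C c) = 0 →
    (∀ c, ∃ (S : ℕ) (f' : Fin S → Fin l → ℤ) (m : Fin S → ℚ) (q' : Fin S → (Fin n → ℝ) → ℝ),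
        (∀ s, IsSemialgebraicFunOn ℚ (C c) (q' s)) ∧
        (∀ s, ∀ x ∈ C c, ∑ j, (f' s j : ℝ) * Real.arctan (u j x) = (m s : ℝ) * Real.pi) ∧
        (∀ x ∈ C c, ∑ s, q' s x * (m s : ℝ) = 0) ∧
        (∀ j, ∀ x ∈ C c, p j x = ∑ s, q' s x * (f' s j : ℝ))) →
    ∑ j, KZ.of (A j) ∈ KZ.relations

end G13
end Summit.KontsevichZagierPeriods.RootDecompRelativeModAbsolute.Rung30571.RegularisedLogLayer.CylLog.Leaf
end
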